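import Summits.Ventures.Crystal3D.Theorems.StickyWulffConstantPolycrystalWulffBoundMergingCalculus
import Summits.Ventures.Crystal3D.Theorems.StickyWulffConstantPolycrystalWulffBoundDominantArith
import Summits.Ventures.Crystal3D.Theorems.StickyWulffConstantPolycrystalWulffBoundSeparated
import Summits.Ventures.Crystal3D.Theorems.StickyWulffConstantPolycrystalWulffBoundSameLattice

/-!
# `PolycrystalWulffBound`, line `PolyDensity`: twin-free textures with a DOMINANT lattice class

Route `StickyWulffConstant` of the venture `Summits/Ventures/Crystal3D`, crux `PolycrystalWulffBound`
(item `stmt-Ventures-19482`), second prover lane (poly-p2, gen 3).  The seat's «grain-count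
DICHOTOMY» has a many-grains half (in the tree: `rung_fineTwinFree_third`, every lattice class
`≤ Vol/3`) and a DOMINANT-GRAIN half, landed here for twin-free polyhedral textures: if ONE lattice
class `D` carries at least `17/20` of the volume, the polycrystal Wulff bound holds — from the crude
tension bracket `B̄(0,√3) ⊆ W ⊆ B̄(0,√5)` alone (no quantitative Wulff inequality).  With
`V = v_D + s` (`s` = satellite volume), `Y` = exterior area of the satellites (half their unit-ball
cross sum with the exterior cells), `A` = unit-ball interface between `D` and the satellites:
* RECOLOURING bound `En ≥ w(V) − (√5 − √3)·Y + A`: the total clause of `exists_exterior_crossSums`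
  gives `Per_{W_D}(E) = Σ_f ½·crossSum_{W_D}(S f, S_X) ≥ w(V)` (one-grain Wulff), and a satellite's
  free energy is `½·crossSum_{W_f} ≥ √3·Y_f ≥ ½·crossSum_{W_D} − (√5 − √3)·Y_f` (monotone in the body);
* PER-CLASS bound `En ≥ w(v_D) − √5·A + √3·Y + A` (merged class `D`: `freeEnergy_class_eq_merged`,
  one-grain Wulff, `ι_W ≤ √5·ι_B`, as in `rung_fineTwinFree_third`);
* isoperimetry of the satellites' union, whose perimeter is `Y + A` (`per_biUnion_eq_sum_sub_sum_iota`);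
* `dominant_arith` closes at `s ≤ (3/20)·V` (structure-free LP ceiling of the pair `≈ 0.16`).
WHAT THIS IS NOT: a registered stub; nothing on textures whose largest class lies strictly between
`Vol/3` and `17/20·Vol`, nor with twins; the crux is not claimed.
-/

noncomputable section

open scoped BigOperators InnerProductSpace ENNReal
open MeasureTheory Filter

namespace Summit.Ventures.Crystal3D.Cruxes.PolycrystalWulffBound.PolyDensity

open Summit.Ventures.Crystal3D.Theorems
open Summit.Ventures.Crystal3D.Cruxes.TextureLiminf.TexShadow (per polytope E3 facetArea supportFn)
open Literature.MathematicalPhysics.StatisticalMechanics (perimeter)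

/-- **Twin-free textures with a dominant lattice class (`≥ 17/20` of the volume)** satisfy the
polycrystal Wulff bound (recolouring bound + per-class bound + isoperimetry of the satellites). -/
theorem rung_dominantTwinFree :
    let Λ : Set (EuclideanSpace ℝ (Fin 3)) := Literature.MathematicalPhysics.StatisticalMechanics.fccStacking 1 (Real.sqrt (2 / 3));
    let Brl : (ℤ → ℤ) → Set (EuclideanSpace ℝ (Fin 3)) := Literature.MathematicalPhysics.StatisticalMechanics.barlowStacking 1 (Real.sqrt (2 / 3));
    let Ax : EuclideanSpace ℝ (Fin 3) → (EuclideanSpace ℝ (Fin 3) ≃ₗᵢ[ℝ] EuclideanSpace ℝ (Fin 3)) → (EuclideanSpace ℝ (Fin 3) ≃ₗᵢ[ℝ] EuclideanSpace ℝ (Fin 3)) → Prop := fun m A B => ∃ (L : EuclideanSpace ℝ (Fin 3) ≃ₗᵢ[ℝ] EuclideanSpace ℝ (Fin 3)) (s₁ s₂ : EuclideanSpace ℝ (Fin 3)) (σ σ' : ℤ → ℤ), Literature.MathematicalPhysics.StatisticalMechanics.IsHaggSeq σ ∧ Literature.MathematicalPhysics.StatisticalMechanics.IsHaggSeq σ'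 ∧ L (EuclideanSpace.single (2 : Fin 3) (1 : ℝ)) = m ∧ A '' Λ ⊆ (fun q => L q + s₁) '' Brl σ ∧ B '' Λ ⊆ (fun q => L q + s₂) '' Brl σ';
    let CoAx : (EuclideanSpace ℝ (Fin 3) ≃ₗᵢ[ℝ] EuclideanSpace ℝ (Fin 3)) → (EuclideanSpace ℝ (Fin 3) ≃ₗᵢ[ℝ] EuclideanSpace ℝ (Fin 3)) → Prop := fun A B => ∃ m, Ax m A B;
    let Φ : EuclideanSpace ℝ (Fin 3) → ℝ := fun ν => Real.sqrt 2 / 4 * ∑ᶠ w ∈ {w ∈ Λ | ‖w‖ = 1}, |⟪w, ν⟫_ℝ|;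
    let Per : Set (EuclideanSpace ℝ (Fin 3)) → Set (EuclideanSpace ℝ (Fin 3)) → ℝ := fun K S => (⨆ (ξ : EuclideanSpace ℝ (Fin 3) → EuclideanSpace ℝ (Fin 3)) (_ : ContDiff ℝ 1 ξ ∧ HasCompactSupport ξ ∧ ∀ z, ξ z ∈ K), ENNReal.ofReal (∫ z in S, Literature.MathematicalPhysics.StatisticalMechanics.fieldDivergence ξ z)).toReal;
    let ι : Set (EuclideanSpace ℝ (Fin 3)) → Set (EuclideanSpace ℝ (Fin 3)) → Set (EuclideanSpace ℝ (Fin 3)) → ℝ := fun K S₁ S₂ => (Per K S₁ + Per K S₂ - Per K (S₁ ∪ S₂)) / 2;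
    let W : (EuclideanSpace ℝ (Fin 3) ≃ₗᵢ[ℝ] EuclideanSpace ℝ (Fin 3)) → Set (EuclideanSpace ℝ (Fin 3)) := fun A => {y | ∀ ν : EuclideanSpace ℝ (Fin 3), ⟪y, ν⟫_ℝ ≤ Φ (A.symm ν)};
    let Dsc : EuclideanSpace ℝ (Fin 3) → Set (EuclideanSpace ℝ (Fin 3)) := fun m => {y | ‖y‖ ≤ 1 ∧ ⟪y, m⟫_ℝ = 0};
    let Tex : (n : ℕ) → (Fin n → Set (EuclideanSpace ℝ (Fin 3))) → (Fin n → (EuclideanSpace ℝ (Fin 3) ≃ₗᵢ[ℝ] EuclideanSpace ℝ (Fin 3))) → (Fin n → Fin n → ℝ) → (Fin n → Fin n → EuclideanSpace ℝ (Fin 3)) → Prop := fun n G A c m => (∀ f : Fin n, Literature.MathematicalPhysics.StatisticalMechanics.HasFinitePerimeter (G f) ∧ volume (G f) < ⊤) ∧ (∀ f g, f ≠ g → Disjoint (G f) (G g)) ∧ (∀ f g, f ≠ g → 0 ≤ c f g) ∧ (∀ f g, f ≠ g → ¬ CoAx (A f) (A g) → m f g = 0 ∧ 1 ≤ c f g)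 ∧ (∀ f g, f ≠ g → CoAx (A f) (A g) → A f '' Λ ≠ A g '' Λ → Ax (m f g) (A f) (A g) ∧ 1 / 2 ≤ c f g);
    let En : (n : ℕ) → (Fin n → Set (EuclideanSpace ℝ (Fin 3))) → (Fin n → (EuclideanSpace ℝ (Fin 3) ≃ₗᵢ[ℝ] EuclideanSpace ℝ (Fin 3))) → (Fin n → Fin n → ℝ) → (Fin n → Fin n → EuclideanSpace ℝ (Fin 3)) → ℝ := fun n G A c m => ∑ f : Fin n, Per (W (A f)) (G f) - ∑ f, ∑ g, (if f = g then 0 else ι (W (A f)) (G f) (G g)) + ∑ f, ∑ g, (if f = g then 0 else c f g / 2 * ι (Dsc (m f g)) (G f) (G g));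
    let Vol : (n : ℕ) → (Fin n → Set (EuclideanSpace ℝ (Fin 3))) → ℝ := fun n G => (volume (⋃ f : Fin n, G f)).toReal;
    let Poly : Set (EuclideanSpace ℝ (Fin 3)) → Prop := fun S => ∃ (k : ℕ) (H : Fin k → Finset ((EuclideanSpace ℝ (Fin 3)) × ℝ)), S = ⋃ i, ⋂ p ∈ H i, {x | ⟪p.1, x⟫_ℝ < p.2};
    let TF : (n : ℕ) → (Fin n → (EuclideanSpace ℝ (Fin 3) ≃ₗᵢ[ℝ] EuclideanSpace ℝ (Fin 3))) → Prop := fun n A => ∀ f g : Fin n, f ≠ g → CoAx (A f) (A g) → A f '' Λ = A g '' Λ;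
    ∀ (n : ℕ) (G : Fin n → Set (EuclideanSpace ℝ (Fin 3))) (A : Fin n → (EuclideanSpace ℝ (Fin 3) ≃ₗᵢ[ℝ] EuclideanSpace ℝ (Fin 3))) (c : Fin n → Fin n → ℝ) (m : Fin n → Fin n → EuclideanSpace ℝ (Fin 3)), Tex n G A c m → (∀ f, Poly (G f)) → TF n A → (∃ f₀ : Fin n, 17 / 20 * Vol n G ≤ (volume (⋃ g ∈ {g : Fin n | A g '' Λ = A f₀ '' Λ}, G g)).toReal) → 6 * (2 : ℝ) ^ ((1 : ℝ) / 3) * (Real.sqrt 2 * Vol n G) ^ ((2 : ℝ) / 3) ≤ En n G A c m  := by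
  intro Λ Brl Ax CoAx Φ Per ι W Dsc Tex En Vol Poly TF n G A c m hTex hPoly hTF hdom
  classical
  obtain ⟨hfin, hdisj, hc0, hgen, -⟩ := hTex
  have hvol : ∀ f, volume (G f) < ⊤ := fun f => (hfin f).2
  obtain ⟨hEm, hEv, hEp, hVsum⟩ := texture_union_facts G hfin hdisj
  obtain ⟨f₀, hf₀⟩ := hdom
  -- lattice classes; the dominant class `D` and the satellites `Dc`
  set lat : Fin n → Set E3 := fun f => A f '' Λ with hlat
  set D : Finset (Fin n) := Finset.univ.filter (fun f => lat f = lat f₀) with hD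
  set Dc : Finset (Fin n) := Finset.univ \ D with hDc
  have hmemD : ∀ f, f ∈ D ↔ lat f = lat f₀ := fun f => by simp [hD]
  have hmemDc : ∀ f, f ∈ Dc ↔ lat f ≠ lat f₀ := fun f => by simp [hDc, hD]
  have hDcsub : D ⊆ Finset.univ := Finset.subset_univ D
  have hDc_eq : Dc = Finset.univ.filter (fun f => ¬ lat f = lat f₀) := by
    ext f; simp [hDc, hD]
  -- pairs in different classes carry generic walls
  have hwall : ∀ f g, lat f ≠ lat g → m f g = 0 ∧ 1 ≤ c f g := fun f g hne =>
    hgen f g (fun h => hne (h ▸ rfl)) (fun hco => hne (hTF f g (fun h => hne (h ▸ rfl)) hco))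
  -- bodies
  have hDsc0 : Dsc 0 = Metric.closedBall (0 : E3) 1 := by
    show {y : E3 | ‖y‖ ≤ 1 ∧ ⟪y, (0 : E3)⟫_ℝ = 0} = Metric.closedBall 0 1
    ext y
    simp [inner_zero_right]
  have hBallc : ∀ r : ℝ, IsCompact (Metric.closedBall (0 : E3) r) := fun r => isCompact_closedBall 0 r
  have hBallv : ∀ r : ℝ, Convex ℝ (Metric.closedBall (0 : E3) r) := fun r => convex_closedBall 0 r
  have hBall0 : ∀ {r : ℝ}, 0 ≤ r → (0 : E3) ∈ Metric.closedBall (0 : E3) r := fun hr =>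
    Metric.mem_closedBall_self hr
  have hBalls : ∀ r : ℝ, -Metric.closedBall (0 : E3) r = Metric.closedBall 0 r := fun r => by
    rw [neg_closedBall, neg_zero]
  have hBc := hBallc 1; have hBv := hBallv 1; have hBs := hBalls 1
  have hB0 : (0 : E3) ∈ Metric.closedBall (0 : E3) 1 := hBall0 zero_le_one
  have h30 : (0 : ℝ) ≤ Real.sqrt 3 := Real.sqrt_nonneg 3; have h50 : (0 : ℝ) ≤ Real.sqrt 5 := Real.sqrt_nonneg 5
  obtain ⟨h3pos, h5pos⟩ : (0 : ℝ) < Real.sqrt 3 ∧ (0 : ℝ) < Real.sqrt 5 := ⟨by positivity, by positivity⟩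
  have hDscC : ∀ v : E3, IsCompact (Dsc v) := fun v =>
    Metric.isCompact_of_isClosed_isBounded
      ((isClosed_le continuous_norm continuous_const).inter
        (isClosed_eq (continuous_id.inner continuous_const) continuous_const))
      (Metric.isBounded_closedBall.subset (cruxDisc_subset_closedBall v))
  have hWc : ∀ f, IsCompact (W (A f)) := fun f => isCompact_cruxWulffBody (A f)
  have hWv : ∀ f, Convex ℝ (W (A f)) := fun f => convex_cruxWulffBody (A f)
  have hW0 : ∀ f, (0 : E3) ∈ W (A f) := fun f => zero_mem_cruxWulffBody (A f); have hWs : ∀ f, -W (A f) = W (A f) := fun f => neg_cruxWulffBody_eq (A f)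
  have hW5 : ∀ f, W (A f) ⊆ Metric.closedBall (0 : E3) (Real.sqrt 5) := fun f =>
    cruxWulffBody_subset_closedBall (A f)
  have hW3 : ∀ f, Metric.closedBall (0 : E3) (Real.sqrt 3) ⊆ W (A f) := fun f =>
    closedBall_subset_cruxWulffBody (A f)
  have hWeq : ∀ f g, lat f = lat g → W (A f) = W (A g) := fun f g h => wulffBody_eq_of_image_eq h
  set K₀ : Set E3 := W (A f₀) with hK₀
  have hKD : ∀ f ∈ D, W (A f) = K₀ := fun f hf => hWeq f f₀ ((hmemD f).1 hf)
  have hperBr : ∀ {r : ℝ}, 0 < r → ∀ S : Set E3, per (Metric.closedBall (0 : E3) r) S =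
      r * per (Metric.closedBall (0 : E3) 1) S := by
    intro r hr S
    rw [per_closedBall_eq_mul_perimeter hr, per_closedBall_eq_mul_perimeter one_pos, one_mul]
  have hperB : ∀ S : Set E3, per (Metric.closedBall (0 : E3) 1) S = (perimeter S).toReal := fun S => by
    rw [per_closedBall_eq_mul_perimeter one_pos S, one_mul]
  -- one common refinement: walls / exterior / total clauses
  obtain ⟨k, H, ν, S, SX, hcross, hext, htot⟩ := exists_exterior_crossSums G hPoly hvol hdisj
  set X : Set E3 → Fin k → Fin k → ℝ := fun K a b =>
    (if a < b then (supportFn K (ν a b) + supportFn K (-ν a b)) *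
        facetArea (closure (polytope (H a)) ∩ closure (polytope (H b))) (ν a b)
      else (supportFn K (ν b a) + supportFn K (-ν b a)) *
        facetArea (closure (polytope (H b)) ∩ closure (polytope (H a))) (ν b a)) with hX
  -- the free energy of a grain w.r.t. a symmetric body `K` is half its exterior cross sum
  have hfree : ∀ K : Set E3, IsCompact K → Convex ℝ K → (0 : E3) ∈ K → -K = K → ∀ f,
      per K (G f) - ∑ g, (if f = g then 0 else (per K (G f) + per K (G g) - per K (G f ∪ G g)) / 2) =
        (∑ a ∈ S f, ∑ b ∈ SX, X K a b) / 2 := by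
    intro K hK hKv hK0 hKs f
    have h : 2 * per K (G f) = (∑ g ∈ Finset.univ.erase f,
        (per K (G f) + per K (G g) - per K (G f ∪ G g))) + ∑ a ∈ S f, ∑ b ∈ SX, X K a b :=
      hext K hK hKv hK0 hKs f
    rw [sum_ite_eq_sum_erase_div_two]
    linarith
  have hmono : ∀ {K K' : Set E3}, K ⊆ K' → Bornology.IsBounded K' → K.Nonempty → ∀ f,
      (∑ a ∈ S f, ∑ b ∈ SX, X K a b) ≤ ∑ a ∈ S f, ∑ b ∈ SX, X K' a b :=
    fun hKK' hK' hKne f => crossSum_mono hKK' hK' hKne H ν (S f) SX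
  have hcs0 : ∀ {K : Set E3}, IsCompact K → (0 : E3) ∈ K → ∀ f, 0 ≤ ∑ a ∈ S f, ∑ b ∈ SX, X K a b :=
    fun hK hK0 f => crossSum_nonneg hK hK0 H ν (S f) SX
  -- exterior areas `Y f` (unit ball) and their scaling
  set Y : Fin n → ℝ := fun f => (∑ a ∈ S f, ∑ b ∈ SX, X (Metric.closedBall (0 : E3) 1) a b) / 2 with hY
  have hYdef : ∀ f, Y f = (∑ a ∈ S f, ∑ b ∈ SX, X (Metric.closedBall (0 : E3) 1) a b) / 2 :=
    fun f => rfl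
  have hY0 : ∀ f, 0 ≤ Y f := fun f => by rw [hYdef]; exact div_nonneg (hcs0 hBc hB0 f) zero_le_two
  have hscale : ∀ {r : ℝ}, 0 < r → ∀ f,
      (∑ a ∈ S f, ∑ b ∈ SX, X (Metric.closedBall (0 : E3) r) a b) / 2 = r * Y f := by
    intro r hr f
    rw [hYdef, ← hfree _ (hBallc r) (hBallv r) (hBall0 hr.le) (hBalls r) f,
      ← hfree _ hBc hBv hB0 hBs f]
    simp_rw [hperBr hr]
    rw [mul_sub, Finset.mul_sum]
    congr 1
    refine Finset.sum_congr rfl fun g _ => ?_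
    split_ifs <;> ring
  -- a grain's free energy is at least `√3 · Y f`; its `K₀`-free energy is at most `√5 · Y f`
  have hfree_ge : ∀ f, Real.sqrt 3 * Y f ≤ (∑ a ∈ S f, ∑ b ∈ SX, X (W (A f)) a b) / 2 := by
    intro f
    rw [← hscale h3pos f]
    exact div_le_div_of_nonneg_right (hmono (hW3 f) (hWc f).isBounded ⟨0, hBall0 h30⟩ f) zero_le_two
  have hfreeK₀_le : ∀ f, (∑ a ∈ S f, ∑ b ∈ SX, X K₀ a b) / 2 ≤ Real.sqrt 5 * Y f := by
    intro f
    rw [← hscale h5pos f]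
    exact div_le_div_of_nonneg_right (hmono (hW5 f₀) Metric.isBounded_closedBall ⟨0, hW0 f₀⟩ f)
      zero_le_two
  -- the unit-ball interface terms `w`
  set w : Fin n → Fin n → ℝ := fun f g => if f = g then 0 else
    (per (Metric.closedBall (0 : E3) 1) (G f) + per (Metric.closedBall (0 : E3) 1) (G g) -
      per (Metric.closedBall (0 : E3) 1) (G f ∪ G g)) / 2 with hw
  have hw0 : ∀ f g, 0 ≤ w f g := by
    intro f g
    by_cases hfg : f = g
    · simp only [hw, hfg, if_true]; exact le_rfl
    · simp only [hw, hfg, if_false]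
      exact div_nonneg (iota_nonneg_of_poly G hPoly hvol hdisj hBc hBv hB0 hfg) zero_le_two
  have hwsymm : ∀ f g, w f g = w g f := fun f g => iota_kernel_symm _ G f g
  -- `per_B (G f) = Σ_g w f g + Y f`
  have hperY : ∀ f, per (Metric.closedBall (0 : E3) 1) (G f) = (∑ g, w f g) + Y f := by
    intro f
    have h := hfree _ hBc hBv hB0 hBs f
    have hY' := hYdef f
    simp only [hw]
    linarith
  -- the dominant/satellite interface `A₁` and its mirror `A₂`
  set A₁ : ℝ := ∑ f ∈ D, ∑ g ∈ Dc, w f g with hA₁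
  set A₂ : ℝ := ∑ f ∈ Dc, ∑ g ∈ D, w f g with hA₂
  have hA₁₂ : A₂ = A₁ := by
    rw [hA₂, hA₁, Finset.sum_comm]
    exact Finset.sum_congr rfl fun f _ => Finset.sum_congr rfl fun g _ => hwsymm g f
  have hA₁0 : 0 ≤ A₁ := Finset.sum_nonneg fun f _ => Finset.sum_nonneg fun g _ => hw0 f g
  set Ysat : ℝ := ∑ f ∈ Dc, Y f with hYsat; have hYsat0 : 0 ≤ Ysat := Finset.sum_nonneg fun f _ => hY0 f
  -- the wall energy dominates the different-class interface terms
  have hterm : ∀ f g, (if lat g = lat f then 0 else w f g) ≤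
      2 * (if f = g then 0 else c f g / 2 * ι (Dsc (m f g)) (G f) (G g)) := by
    intro f g
    by_cases hfg : f = g
    · rw [if_pos (by rw [hfg]), if_pos hfg, mul_zero]
    · rw [if_neg hfg]
      by_cases hl : lat g = lat f
      · rw [if_pos hl]
        have hnn := iota_nonneg_of_poly G hPoly hvol hdisj (hDscC (m f g)) (convex_cruxDisc (m f g))
          (zero_mem_cruxDisc (m f g)) hfg
        have hc := hc0 f g hfg
        show (0 : ℝ) ≤ 2 * (c f g / 2 * ((per (Dsc (m f g)) (G f) + per (Dsc (m f g)) (G g) -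
          per (Dsc (m f g)) (G f ∪ G g)) / 2))
        have : 0 ≤ c f g * (per (Dsc (m f g)) (G f) + per (Dsc (m f g)) (G g) -
          per (Dsc (m f g)) (G f ∪ G g)) := mul_nonneg hc hnn
        linarith
      · rw [if_neg hl]
        obtain ⟨hm, hc⟩ := hwall f g (fun h => hl h.symm)
        rw [hm, hDsc0]
        have hnn := iota_nonneg_of_poly G hPoly hvol hdisj hBc hBv hB0 hfg
        simp only [hw, hfg, if_false]
        show (per (Metric.closedBall (0 : E3) 1) (G f) + per (Metric.closedBall (0 : E3) 1) (G g) -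
            per (Metric.closedBall (0 : E3) 1) (G f ∪ G g)) / 2 ≤
          2 * (c f g / 2 * ((per (Metric.closedBall (0 : E3) 1) (G f) +
            per (Metric.closedBall (0 : E3) 1) (G g) - per (Metric.closedBall (0 : E3) 1) (G f ∪ G g)) / 2))
        nlinarith
  have hWl : (∑ f, ∑ g, (if lat g = lat f then 0 else w f g)) ≤
      2 * ∑ f, ∑ g, (if f = g then 0 else c f g / 2 * ι (Dsc (m f g)) (G f) (G g)) := by
    have hsum : (∑ f, ∑ g, (if lat g = lat f then 0 else w f g)) ≤
        ∑ f, ∑ g, 2 * (if f = g then 0 else c f g / 2 * ι (Dsc (m f g)) (G f) (G g)) :=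
      Finset.sum_le_sum fun f _ => Finset.sum_le_sum fun g _ => hterm f g
    simp_rw [← Finset.mul_sum] at hsum
    exact hsum
  -- `A₁ + A₂ ≤ Σ_f Σ_g [different classes] w f g`
  have hsplit : ∀ F : Fin n → ℝ, (∑ f, F f) = (∑ f ∈ D, F f) + ∑ f ∈ Dc, F f := by
    intro F
    rw [hDc, ← Finset.sum_sdiff hDcsub, add_comm]
  have hinnerD : ∀ f ∈ D, (∑ g, (if lat g = lat f then 0 else w f g)) = ∑ g ∈ Dc, w f g := by
    intro f hf
    rw [(hmemD f).1 hf, hDc_eq, Finset.sum_filter]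
    refine Finset.sum_congr rfl fun g _ => ?_
    by_cases h : lat g = lat f₀
    · rw [if_pos h, if_neg (not_not.2 h)]
    · rw [if_neg h, if_pos h]
  have hinnerDc : ∀ f ∈ Dc, (∑ g ∈ D, w f g) ≤ ∑ g, (if lat g = lat f then 0 else w f g) := by
    intro f hf
    have hlf : lat f ≠ lat f₀ := (hmemDc f).1 hf
    calc (∑ g ∈ D, w f g) = ∑ g ∈ D, (if lat g = lat f then 0 else w f g) := by
          refine Finset.sum_congr rfl fun g hg => ?_
          rw [if_neg (fun h => hlf (h.symm.trans ((hmemD g).1 hg)))]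
      _ ≤ ∑ g, (if lat g = lat f then 0 else w f g) :=
          Finset.sum_le_sum_of_subset_of_nonneg (Finset.subset_univ D) fun g _ _ => by
            split_ifs
            · exact le_rfl
            · exact hw0 f g
  have hAle : A₁ + A₂ ≤ ∑ f, ∑ g, (if lat g = lat f then 0 else w f g) := by
    have e := hsplit (fun f => ∑ g, (if lat g = lat f then 0 else w f g))
    have eD : (∑ f ∈ D, ∑ g, (if lat g = lat f then 0 else w f g)) = A₁ := Finset.sum_congr rfl hinnerD
    have eDc : A₂ ≤ ∑ f ∈ Dc, ∑ g, (if lat g = lat f then 0 else w f g) := Finset.sum_le_sum hinnerDc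
    linarith
  have hWallA : A₁ ≤ ∑ f, ∑ g, (if f = g then 0 else c f g / 2 * ι (Dsc (m f g)) (G f) (G g)) := by
    linarith
  -- facts on the two merged families
  have hfactsD := subfamily_union_facts G hfin hdisj D
  have hfactsDc := subfamily_union_facts G hfin hdisj Dc
  set vD : ℝ := (volume (⋃ f ∈ D, G f)).toReal with hvD
  set s : ℝ := (volume (⋃ f ∈ Dc, G f)).toReal with hs
  have hvD0 : 0 ≤ vD := ENNReal.toReal_nonneg; have hs0 : 0 ≤ s := ENNReal.toReal_nonneg
  have hV : Vol n G = vD + s := by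
    show (volume (⋃ f, G f)).toReal = vD + s
    rw [hVsum, hfactsD.2.2.2, hfactsDc.2.2.2]
    exact hsplit _
  have hsmall : s ≤ 3 / 20 * Vol n G := by
    have hset : (⋃ f ∈ D, G f) = ⋃ g ∈ {g : Fin n | A g '' Λ = A f₀ '' Λ}, G g := by
      ext x
      simp only [Set.mem_iUnion, Finset.mem_filter, Finset.mem_univ, true_and, Set.mem_setOf_eq,
        exists_prop, hlat, hD]
    have h : 17 / 20 * Vol n G ≤ vD := by rw [hvD, hset]; exact hf₀
    rw [hV] at h ⊢
    linarith
  -- PER-CLASS BOUND for the dominant class (as in `rung_fineTwinFree_third`)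
  have hιW_le : ∀ f g, f ≠ g →
      per (W (A f)) (G f) + per (W (A f)) (G g) - per (W (A f)) (G f ∪ G g) ≤
        Real.sqrt 5 * (per (Metric.closedBall (0 : E3) 1) (G f) +
          per (Metric.closedBall (0 : E3) 1) (G g) - per (Metric.closedBall (0 : E3) 1) (G f ∪ G g)) := by
    intro f g hfg
    have h1 := hcross (W (A f)) (hWc f) (hWv f) (hW0 f) f g hfg
    have h2 := hcross (Metric.closedBall (0 : E3) (Real.sqrt 5)) (hBallc _) (hBallv _) (hBall0 h50) f g hfg
    have hmono' := crossSum_mono (hW5 f) Metric.isBounded_closedBall ⟨0, hW0 f⟩ H ν (S f) (S g)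
    rw [← h1, ← h2, hperBr h5pos, hperBr h5pos, hperBr h5pos] at hmono'
    linarith
  have hclassD : 6 * (2 : ℝ) ^ ((1 : ℝ) / 3) * (Real.sqrt 2 * vD) ^ ((2 : ℝ) / 3) - Real.sqrt 5 * A₁ ≤
      ∑ f ∈ D, (per (W (A f)) (G f) - ∑ g, (if f = g then 0 else
          (per (W (A f)) (G f) + per (W (A f)) (G g) - per (W (A f)) (G f ∪ G g)) / 2)) := by
    have hX' : (∑ f ∈ D, (per (W (A f)) (G f) - ∑ g, (if f = g then 0 else
          (per (W (A f)) (G f) + per (W (A f)) (G g) - per (W (A f)) (G f ∪ G g)) / 2))) =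
        ∑ f ∈ D, (per K₀ (G f) - ∑ g, (if f = g then 0 else
            (per K₀ (G f) + per K₀ (G g) - per K₀ (G f ∪ G g)) / 2)) :=
      Finset.sum_congr rfl fun f hf => by rw [hKD f hf]
    rw [hX', freeEnergy_class_eq_merged G hPoly hvol hdisj (hWc f₀) (hWv f₀) (hW0 f₀) (hWs f₀) _]
    have hWulff : 6 * (2 : ℝ) ^ ((1 : ℝ) / 3) * (Real.sqrt 2 * vD) ^ ((2 : ℝ) / 3) ≤
        per K₀ (⋃ f ∈ D, G f) :=
      polycrystalWulffBound_singleGrain (A f₀) ⟨hfactsD.1, lt_top_iff_ne_top.2 hfactsD.2.2.1⟩ hfactsD.2.1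
    have hover : (∑ g ∈ Finset.univ \ D,
        (per K₀ (⋃ f ∈ D, G f) + per K₀ (G g) - per K₀ ((⋃ f ∈ D, G f) ∪ G g)) / 2) ≤
        Real.sqrt 5 * A₁ := by
      have hadd : ∀ g ∈ Finset.univ \ D,
          (per K₀ (⋃ f ∈ D, G f) + per K₀ (G g) - per K₀ ((⋃ f ∈ D, G f) ∪ G g)) / 2 ≤
          Real.sqrt 5 * ∑ f ∈ D, w f g := by
        intro g hg
        have hg' : g ∉ D := (Finset.mem_sdiff.1 hg).2
        rw [two_iota_biUnion_left G hPoly hvol hdisj (hWc f₀) (hWv f₀) (hW0 f₀) (hWs f₀) hg',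
          Finset.sum_div, Finset.mul_sum]
        refine Finset.sum_le_sum fun f hf => ?_
        have hfg : f ≠ g := fun h => hg' (h ▸ hf)
        have hle := hιW_le f g hfg
        rw [hKD f hf] at hle
        simp only [hw, hfg, if_false]
        nlinarith
      refine (Finset.sum_le_sum hadd).trans (le_of_eq ?_)
      rw [← Finset.mul_sum, Finset.sum_comm]
    linarith
  -- satellites: free energy ≥ √3 · Y
  have hsat : Real.sqrt 3 * Ysat ≤ ∑ f ∈ Dc, (per (W (A f)) (G f) - ∑ g, (if f = g then 0 else
      (per (W (A f)) (G f) + per (W (A f)) (G g) - per (W (A f)) (G f ∪ G g)) / 2)) := by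
    rw [hYsat, Finset.mul_sum]
    refine Finset.sum_le_sum fun f _ => ?_
    rw [hfree _ (hWc f) (hWv f) (hW0 f) (hWs f) f]
    exact hfree_ge f
  -- RECOLOURING BOUND: free energy ≥ per K₀ E − (√5 − √3)·Ysat
  have htotK₀ : per K₀ (⋃ f, G f) = ∑ f, (∑ a ∈ S f, ∑ b ∈ SX, X K₀ a b) / 2 := by
    have h := htot K₀ (hWc f₀) (hWv f₀) (hW0 f₀) (hWs f₀)
    rw [← Finset.sum_div]
    linarith
  have hWulffE : 6 * (2 : ℝ) ^ ((1 : ℝ) / 3) * (Real.sqrt 2 * Vol n G) ^ ((2 : ℝ) / 3) ≤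
      per K₀ (⋃ f, G f) :=
    polycrystalWulffBound_singleGrain (A f₀) ⟨hEm, lt_top_iff_ne_top.2 hEp⟩ hEv
  have hrecol : per K₀ (⋃ f, G f) - (Real.sqrt 5 - Real.sqrt 3) * Ysat ≤
      ∑ f, (per (W (A f)) (G f) - ∑ g, (if f = g then 0 else
        (per (W (A f)) (G f) + per (W (A f)) (G g) - per (W (A f)) (G f ∪ G g)) / 2)) := by
    have e1 : (∑ f, (∑ a ∈ S f, ∑ b ∈ SX, X K₀ a b) / 2) =
        (∑ f ∈ D, (∑ a ∈ S f, ∑ b ∈ SX, X K₀ a b) / 2) + ∑ f ∈ Dc, (∑ a ∈ S f, ∑ b ∈ SX, X K₀ a b) / 2 :=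
      hsplit _
    have e2 : (∑ f, (per (W (A f)) (G f) - ∑ g, (if f = g then 0 else
        (per (W (A f)) (G f) + per (W (A f)) (G g) - per (W (A f)) (G f ∪ G g)) / 2))) =
        (∑ f ∈ D, (per (W (A f)) (G f) - ∑ g, (if f = g then 0 else
          (per (W (A f)) (G f) + per (W (A f)) (G g) - per (W (A f)) (G f ∪ G g)) / 2))) +
        ∑ f ∈ Dc, (per (W (A f)) (G f) - ∑ g, (if f = g then 0 else
          (per (W (A f)) (G f) + per (W (A f)) (G g) - per (W (A f)) (G f ∪ G g)) / 2)) :=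
      hsplit _
    have e3 : (Real.sqrt 5 - Real.sqrt 3) * Ysat = ∑ f ∈ Dc, (Real.sqrt 5 - Real.sqrt 3) * Y f := by
      rw [hYsat, Finset.mul_sum]
    have hDpart : (∑ f ∈ D, (∑ a ∈ S f, ∑ b ∈ SX, X K₀ a b) / 2) =
        ∑ f ∈ D, (per (W (A f)) (G f) - ∑ g, (if f = g then 0 else
          (per (W (A f)) (G f) + per (W (A f)) (G g) - per (W (A f)) (G f ∪ G g)) / 2)) :=
      Finset.sum_congr rfl fun f hf => by rw [hKD f hf, hfree _ (hWc f₀) (hWv f₀) (hW0 f₀) (hWs f₀) f]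
    have hDcpart : (∑ f ∈ Dc, (∑ a ∈ S f, ∑ b ∈ SX, X K₀ a b) / 2) -
        (∑ f ∈ Dc, (Real.sqrt 5 - Real.sqrt 3) * Y f) ≤
        ∑ f ∈ Dc, (per (W (A f)) (G f) - ∑ g, (if f = g then 0 else
          (per (W (A f)) (G f) + per (W (A f)) (G g) - per (W (A f)) (G f ∪ G g)) / 2)) := by
      rw [← Finset.sum_sub_distrib]
      refine Finset.sum_le_sum fun f _ => ?_
      rw [hfree _ (hWc f) (hWv f) (hW0 f) (hWs f) f]
      have h1 := hfreeK₀_le f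
      have h2 := hfree_ge f
      linarith
    rw [htotK₀, e1, e2, e3]
    linarith
  -- ISOPERIMETRY of the satellites: `c · s^{2/3} ≤ Ysat + A₁`
  have hisoS := isoperimetric_toReal_three hfactsDc.1 hfactsDc.2.1 hfactsDc.2.2.1
  have hPerS : (perimeter (⋃ f ∈ Dc, G f)).toReal = Ysat + A₁ := by
    have hIE : per (Metric.closedBall (0 : E3) 1) (⋃ f ∈ Dc, G f) =
        (∑ f ∈ Dc, per (Metric.closedBall (0 : E3) 1) (G f)) - ∑ f ∈ Dc, ∑ g ∈ Dc, w f g :=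
      per_biUnion_eq_sum_sub_sum_iota G hPoly hvol hdisj hBc hBv hB0 hBs Dc
    have e4 : (∑ f ∈ Dc, per (Metric.closedBall (0 : E3) 1) (G f)) = (∑ f ∈ Dc, ∑ g, w f g) + Ysat := by
      rw [hYsat, ← Finset.sum_add_distrib]
      exact Finset.sum_congr rfl fun f _ => hperY f
    have e5 : (∑ f ∈ Dc, ∑ g, w f g) = (∑ f ∈ Dc, ∑ g ∈ D, w f g) + ∑ f ∈ Dc, ∑ g ∈ Dc, w f g := by
      rw [← Finset.sum_add_distrib]
      exact Finset.sum_congr rfl fun f _ => hsplit (w f)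
    rw [← hperB, hIE, ← hA₁₂]
    linarith
  rw [hPerS] at hisoS
  -- assemble
  have hEn : En n G A c m =
      (∑ f, (Per (W (A f)) (G f) - ∑ g, (if f = g then 0 else ι (W (A f)) (G f) (G g)))) +
        ∑ f, ∑ g, (if f = g then 0 else c f g / 2 * ι (Dsc (m f g)) (G f) (G g)) := by
    show (∑ f, Per (W (A f)) (G f) -
        ∑ f, ∑ g, (if f = g then 0 else ι (W (A f)) (G f) (G g)) +
        ∑ f, ∑ g, (if f = g then 0 else c f g / 2 * ι (Dsc (m f g)) (G f) (G g))) =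
      (∑ f, (Per (W (A f)) (G f) - ∑ g, (if f = g then 0 else ι (W (A f)) (G f) (G g)))) +
        ∑ f, ∑ g, (if f = g then 0 else c f g / 2 * ι (Dsc (m f g)) (G f) (G g))
    rw [Finset.sum_sub_distrib]
  have hFree : (∑ f, (Per (W (A f)) (G f) - ∑ g, (if f = g then 0 else ι (W (A f)) (G f) (G g)))) =
      (∑ f ∈ D, (per (W (A f)) (G f) - ∑ g, (if f = g then 0 else
          (per (W (A f)) (G f) + per (W (A f)) (G g) - per (W (A f)) (G f ∪ G g)) / 2))) +
        ∑ f ∈ Dc, (per (W (A f)) (G f) - ∑ g, (if f = g then 0 else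
          (per (W (A f)) (G f) + per (W (A f)) (G g) - per (W (A f)) (G f ∪ G g)) / 2)) :=
    hsplit _
  have h1 : 6 * (2 : ℝ) ^ ((1 : ℝ) / 3) * (Real.sqrt 2 * Vol n G) ^ ((2 : ℝ) / 3) -
      (Real.sqrt 5 - Real.sqrt 3) * Ysat + A₁ ≤ En n G A c m := by
    rw [hEn]
    have hr : per K₀ (⋃ f, G f) - (Real.sqrt 5 - Real.sqrt 3) * Ysat ≤
        ∑ f, (Per (W (A f)) (G f) - ∑ g, (if f = g then 0 else ι (W (A f)) (G f) (G g))) := hrecol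
    linarith
  have h2 : 6 * (2 : ℝ) ^ ((1 : ℝ) / 3) * (Real.sqrt 2 * vD) ^ ((2 : ℝ) / 3) +
      Real.sqrt 3 * Ysat - (Real.sqrt 5 - 1) * A₁ ≤ En n G A c m := by
    rw [hEn, hFree]
    linarith
  exact dominant_arith isoConst_three_pos (le_of_eq isoConst_three_cube.symm) hvD0 hs0 hV hsmall
    hYsat0 hA₁0 hisoS h1 h2

end Summit.Ventures.Crystal3D.Cruxes.PolycrystalWulffBound.PolyDensity

end
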